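import Summits.QuantumAdvantage.QuantumAdvantage.Theses.GenericInertness

/-!
# Birth skeleton (BC3) for crux `LangInertness` — route `GenericInertness`
# "force categoricity; decide with PROMISE help (InertnessMachine); trade the promise oracle for ONE BQP language"

Skeleton registrar `planner-skel-stmt-QuantumAdvantage-10361-0`, 2026-08-17 (route re-audit bin REPAIRABLE).

TARGET (FIXED, concluded BY NAME): the route decl
`Summit.QuantumAdvantage.QuantumAdvantage.Theses.GenericInertness.LangInertness`
(item stmt-QuantumAdvantage-10361, rank 2 of route-QuantumAdvantage-GenericInertness):

  `∃ 𝒮 countable, ∀ G, IsGeneric 𝒮 G → BQP^G ⊆ ⋃ L ∈ BQP, BPP^(G ⊕ L)`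

— relative to a Cohen generic, quantum polynomial time gets nothing that classical randomized
polynomial time with the same generic and ONE unrelativized `BQP` LANGUAGE cannot get.

## The cut (two named stubs + the route's rank-3 crux by name; none is the crux, none is the summit)

The route header fixes the line: "InertnessMachine gives `BQP^G ⊆ P^{G ⊕ Π}`, `Π ∈ PromiseBQP`; it
remains to replace the PROMISE oracle by a LANGUAGE oracle". A proof along it has three joints:

* `stub_categoricalCover` — THE GENERICITY LAYER (Fenner–Fortnow–Kurtz–Li 2003 §6.5, Lemma 6.8
  pattern; the tree's `FFKLGenericCollapse.lean` does the same for `AWPP` descriptions): there is a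
  countable family `𝒮` of sets of Cohen conditions (one dense forcing set per uniform Clifford+T
  oracle family `F`, countably many by `countable_setOf_isUniform`) such that relative to every
  `𝒮`-generic `G`, every `K ∈ BQP^G` is the language `{x | acc_F^G(x) ≥ 2/3}` of a uniform family
  `F` that is CATEGORICAL over some finite condition `σ` extended by `G` (proper at every input for
  EVERY oracle extending `σ`). Density: below any `τ`, either some oracle `Z ⊇ τ` and input `x` have
  `acc_F^Z(x) ∈ (1/3, 2/3)` — the circuit `F.circ |x|` reads `Z` only on the finitely many strings of
  its query widths, so a finite extension of `τ` forces improperness at `x` — or `F` is categorical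
  over `τ`; a generic `G` at which `F` is proper meets the set on the categorical side.
  [provable now; M]
* `InertnessMachine` — NOT a stub: the route's rank-3 crux (stmt-QuantumAdvantage-10362, separately
  staffed) enters the composition as a registered obligation BY NAME: a uniform family categorical over
  `σ` is decided, for every `G ⊇ σ`, by ONE deterministic polynomial-time machine relative to `G ⊕ O`
  for EVERY separator `O` of ONE promise problem `Q ∈ PromiseBQP` (certificate-by-heavy-set + majority
  voting). [the route's new theorem; L]
* `stub_langHelpOfPromiseHelp` — THE RESIDUE, LANGUAGE HELP GIVEN PROMISE HELP: for a uniform `F`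
  categorical over `σ`, a `Q ∈ PromiseBQP` and ONE poly-time `M` deciding `L(F^G)` relative to
  `G ⊕ O` for every separator `O` of `Q` and every `G ⊇ σ` (verbatim what `InertnessMachine` delivers), for
  every `G ⊇ σ` some unrelativized LANGUAGE `L ∈ BQP` and randomness suffice:
  `L(F^G) ∈ BPP^(G ⊕ L)`. Both handles stay available to the prover — the robust promise machine
  `M` (general transfer) and the family `F` (redo the heavy-query dynamics with slack / random
  thresholds and a canonical BQP helper). Holds if every `PromiseBQP` problem has a `BQP` separator
  (that road also proves PL, stmt-0250: kill criterion (i)), if `PromiseBQP ⊆ PromiseBPP'`, or if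
  `P = PSPACE`; its negation implies `P ≠ PSPACE`. The difficulty named by the route ("approximate
  counting with gap-free help", prBPP-vs-BPP type) lives exactly here. [open; L–XL]

COMPOSITION `LangInertness_of : Goal.stub_categoricalCover → InertnessMachine →
Goal.stub_langHelpOfPromiseHelp → LangInertness` (kernel-checked, no `sorry` of its own, 8 tactic
lines): take `𝒮` from stub 1; for `𝒮`-generic `G` and `K ∈ BQP^G` get `F, σ` (stub 1), then `Q, M, q`
(`InertnessMachine`), then `L` (stub 2 at this `G ⊇ σ`), and `K = {x | acc_F^G(x) ≥ 2/3}` by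
extensionality.

Imports: the route file only (its cone: Mathlib, GenericOracles, OracleJoin, Promise, ClassBQP) — no
`Literature.Barriers.*` module, as the route's CONE HYGIENE note requires.
-/

set_option linter.dupNamespace false

namespace Summit.QuantumAdvantage.QuantumAdvantage.Cruxes.LangInertness.Birth

open Literature.Computability.Complexity Literature.Computability.Cryptography
open Summit.QuantumAdvantage.QuantumAdvantage.Theses.GenericInertness

/-! ## Statements under the stub names
(the A12 skeleton audit reads the hypotheses of `LangInertness_of` by the HEAD NAME of their types:
each head below is a declared stub name; the middle hypothesis is the route item `InertnessMachine`
itself, a registered obligation, by name). -/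
namespace Goal

/-- Statement of `stub_categoricalCover`: THE GENERICITY LAYER — there is a countable family `𝒮` of sets
of Cohen conditions such that relative to every `𝒮`-generic `G`, every `K ∈ BQP^G` is the language
`{x | acc_F^G(x) ≥ 2/3}` of a uniform Clifford+T oracle family `F` CATEGORICAL over some finite condition
`σ` extended by `G` (acceptance probability `∉ (1/3, 2/3)` at every input for EVERY oracle extending `σ`). -/
abbrev stub_categoricalCover : Prop :=
  ∃ 𝒮 : Set (Set CohenCondition), 𝒮.Countable ∧
    ∀ G : Language Bool, IsGeneric 𝒮 G →
      ∀ K ∈ BQPRel G,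
        ∃ F : QCircuitFamily cliffordT, F.IsUniform ∧
          ∃ σ : CohenCondition, σ.ExtendedBy G ∧
            (∀ Z : Language Bool, σ.ExtendedBy Z → ∀ x : List Bool,
                F.acceptProbOn Z x ≤ 1 / 3 ∨ 2 / 3 ≤ F.acceptProbOn Z x) ∧
            ∀ x : List Bool, x ∈ K ↔ 2 / 3 ≤ F.acceptProbOn G x

/-- Statement of `stub_langHelpOfPromiseHelp`: LANGUAGE HELP FOR CATEGORICAL FAMILIES, GIVEN PROMISE HELP —
for a uniform `F` categorical over `σ`, a `Q ∈ PromiseBQP` and a polynomial-time oracle machine `M`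
(fuel / query-length bound `q`) deciding `x ↦ [acc_F^G(x) ≥ 2/3]` relative to `G ⊕ O` for EVERY separator
`O` of `Q` and EVERY `G ⊇ σ` (verbatim the conclusion of `InertnessMachine`), for every `G ⊇ σ` ONE
unrelativized language `L ∈ BQP` and coins suffice: `{x | acc_F^G(x) ≥ 2/3} ∈ BPP^(G ⊕ L)`. -/
abbrev stub_langHelpOfPromiseHelp : Prop :=
  ∀ F : QCircuitFamily cliffordT, F.IsUniform → ∀ σ : CohenCondition,
    (∀ Z : Language Bool, σ.ExtendedBy Z → ∀ x : List Bool,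
        F.acceptProbOn Z x ≤ 1 / 3 ∨ 2 / 3 ≤ F.acceptProbOn Z x) →
    ∀ Q ∈ PromiseBQP, ∀ M : OracleAlg Bool, M.IsPolyTime _root_.Computability.encodingBoolBool →
      ∀ q : Polynomial ℕ,
        (∀ O : Language Bool, Q.yes ≤ O → Q.no ≤ Oᶜ → ∀ G : Language Bool, σ.ExtendedBy G →
            ∀ x : List Bool,
              (∃ b : Bool, M.run (Oracle.ofLanguage (oracleJoin G O)) (q.eval x.length) x = some b ∧
                  (b = true ↔ 2 / 3 ≤ F.acceptProbOn G x)) ∧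
                ∀ y ∈ M.queries (Oracle.ofLanguage (oracleJoin G O)) (q.eval x.length) x,
                  y.length ≤ q.eval x.length) →
        ∀ G : Language Bool, σ.ExtendedBy G →
          ∃ L ∈ BQP, {x : List Bool | 2 / 3 ≤ F.acceptProbOn G x} ∈
            BPPRel (Oracle.ofLanguage (oracleJoin G L))

end Goal

/-! ## The two stubs (the ONLY `sorry`s of this file) -/

/-- STUB 1 (M, provable now): THE GENERICITY LAYER (statement `Goal.stub_categoricalCover`). Proof plan:
`𝒮 := {D_F | F uniform}` with `D_F := {τ | τ forces "acc_F^Z(x) ∈ (1/3,2/3) for some x" ∨ F categorical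
over τ}`; each `D_F` is dense (a violation of properness at `x` below `τ` reads `Z` only on the finitely
many strings of the query widths of `F.circ |x|`, so a finite extension `restrict Z s ≥ τ` forces it —
`le_restrict_of_extendedBy`; otherwise `F` is categorical over `τ`); `𝒮` is countable by
`countable_setOf_isUniform`; a generic `G` meets `D_F` at some `σ ⊆ G` (`IsGeneric`, `Meets`), and the
forcing side contradicts the properness of the `BQPRel` witness `F` at `G`, so `F` is categorical over
`σ`; `K = {x | acc ≥ 2/3}` since `acc ≤ 1/3 < 2/3` off `K`. [FennerFortnowKurtzLi2003IC §6.5 (p. 32),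
Lemma 6.8; tree pattern `Literature/Barriers/QuantumAdvantage/FFKLGenericCollapse.lean`
(`AWPPDescr.prom_congr`, `FFKL.exists_forces_not_prom`, `FFKL.isDense_forces_req_of_stdAlg`,
`FFKL.family_countable`); `Literature.Computability.Cryptography.countable_setOf_isUniform`] -/
theorem stub_categoricalCover : Goal.stub_categoricalCover := by
  sorry

/-- STUB 2 (L–XL, the open residue): LANGUAGE HELP FOR CATEGORICAL FAMILIES, GIVEN PROMISE HELP
(statement `Goal.stub_langHelpOfPromiseHelp`). Both handles are deliberately kept: the robust promise
machine `M` (a general "robust `PromiseBQP` help ⇒ `BQP`-language help + coins" transfer proves it: `M`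
is correct whatever the off-promise answers are, so it suffices to answer the on-promise `Q`-queries
correctly w.h.p. from `L` and coins, memoising within a run) AND the family `F` itself (re-run the
certificate+voting dynamics of `InertnessMachine` — reveal the δ-heavy unrevealed queries of the run of
`F` on the explicit sparse oracle `ρ_k ∪ 0`, default answers, majority over `512T⁴+1` rounds — with the
weight thresholds chosen with slack / at random and a canonical (pseudo-deterministic) BQP helper for the
additive approximate-counting questions, so that no general transfer is needed). Holds if every
`PromiseBQP` problem has a `BQP` separator (⇔ pseudo-deterministic additive approximate counting in
quantum polynomial time — but that road also proves PL, stmt-QuantumAdvantage-0250, and retires the route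
as superseded: kill criterion (i)), if `PromiseBQP ⊆ PromiseBPP'` (amplify a textbook prBPP decider, answer
`M`'s `O`-queries with it: `BPP^G`), or if `P = PSPACE` (FFKL Thm 6.18(2): `L := ∅`); its negation implies
`P ≠ PSPACE`, so no cheap refutation exists. WHY IT MIGHT FAIL: a language helper must be proper at
gap-less thresholds (the prBPP-vs-BPP obstruction, Goldreich 2011 §6); near-threshold instances of the
heavy-query questions have no gap unless the dynamics tolerates randomly shifted thresholds.
[Goldreich2011 §6; AaronsonGurLi2026 Thm 1.7 (pseudo-deterministic quantum search);
FennerFortnowKurtzLi2003IC L.6.16–6.17, Thm 6.18(2) (pp. 32–33); Fortnow2001Derandomization §2;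
BennettBernsteinBrassardVazirani1997 Thm 3.3 (heavy queries)] -/
theorem stub_langHelpOfPromiseHelp : Goal.stub_langHelpOfPromiseHelp := by
  sorry

/-! ## The composition -/

/-- COMPOSITION (no `sorry` of its own): the genericity layer, the route's rank-3 crux `InertnessMachine`
(stmt-QuantumAdvantage-10362, a registered obligation, BY NAME) and the language-help residue give the
crux, concluded BY NAME. -/
theorem LangInertness_of :
    Goal.stub_categoricalCover → InertnessMachine → Goal.stub_langHelpOfPromiseHelp → LangInertness := by
  intro h₁ h₂ h₃
  obtain ⟨𝒮, h𝒮c, h𝒮⟩ := h₁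
  refine ⟨𝒮, h𝒮c, fun G hG K hK => ?_⟩
  obtain ⟨F, hU, σ, hσG, hcat, hKF⟩ := h𝒮 G hG K hK
  obtain ⟨Q, hQ, M, hM, q, hMq⟩ := h₂ F hU σ hcat
  obtain ⟨L, hL, hmem⟩ := h₃ F hU σ hcat Q hQ M hM q hMq G hσG
  have hKeq : K = {x : List Bool | 2 / 3 ≤ F.acceptProbOn G x} := Set.ext hKF
  exact Set.mem_iUnion₂.mpr ⟨L, hL, hKeq ▸ hmem⟩

end Summit.QuantumAdvantage.QuantumAdvantage.Cruxes.LangInertness.Birth
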